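import Summits.QuantumFields.YangMills.Theorems.SandwichVariancePinchingCeilingBL
import Summits.QuantumFields.YangMills.Theorems.SandwichVariancePinchingFloorWhitenedSmooth
import Summits.QuantumFields.YangMills.Theorems.LogConcaveChartTransportRemainderDeriv
import Summits.QuantumFields.YangMills.Theorems.LogConcaveChartTransportIsotropic

/-!
# Route `SandwichVariancePinching` — crux `QuadraticVarianceCeiling` (stmt-QuantumFields-28259):
# toolkit I for the smooth whitened CEILING — defect bound, row Brascamp–Lieb, second moment of the score

For a `C²` potential `A` on `ℝⁿ` with the whitened second-difference sandwich (`0 ≤ δ < 1`) and centring: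
* `defect_sq_le` — the DEFECT BOUND `|(D²A(x) − 1)u|² ≤ δ²|u|²` (the symmetric form `D²A − 1` has diagonal
  values in `[−δ|v|², δ|v|²]`; polarisation with a free parameter + discriminant);
* growth bookkeeping for linear and quadratic observables (`abs_dotProduct_le_growth`, `quadObs_growth`);
* `integral_sq_dotProduct_le`, `integral_mulVec_sq_le` — first-order Brascamp–Lieb on LINEAR observables:
  `∫(w·x)²e^{−A} ≤ (1−δ)⁻¹|w|²·Z`, `∫|Hx|²e^{−A} ≤ (1−δ)⁻¹ tr(H²)·Z` (`…CeilingBL.bl_raw_of_sandwich`);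
* `score_sq_le` — `∫ (∂_{Hx+b}A − trH)² e^{−A} ≤ tr(H²)Z + (1+δ)(∫|Hx|²e^{−A} + |b|²Z)` (score identity (I2)
  of `…ScoreSecondMoment` + the pointwise Hessian bound).

HONEST SCOPE.  Free-hands work of the LEAD seat of crux stmt-QuantumFields-22884 (cell ym-idea-1) toward crux 28259
of planner ym-idea-3's draft-by-design sub-line; helper lemmas only — nothing here proves the ceiling,
`QuadraticCovarianceComparison` (26240), the `LogConcaveChart` thesis, rung R2a or any summit statement; the
Yang–Mills mass gap is NOT proved by any of this.
-/

noncomputable section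

namespace Summit.QuantumFields.YangMills.Theorems.SandwichVariancePinching

open MeasureTheory Real Filter Topology
open Literature.Probability.Distributions (coordGradient coordHessian)
open Summit.QuantumFields.YangMills.Cruxes.TransportCovarianceTransfer

variable {n : ℕ}

/-- DEFECT VECTOR BOUND: for a sandwiched `C²` potential and any `u`, the vector
`s_j := D²A(x)(e_j, u) − u_j` satisfies `|s|² ≤ δ²|u|²` (the symmetric form `D²A(x) − 1` has all
diagonal values in `[−δ|v|², δ|v|²]`, hence operator norm `≤ δ`: discriminant argument). [folklore] -/
theorem defect_sq_le {A : (Fin n → ℝ) → ℝ} (hA : ContDiff ℝ 2 A) {δ : ℝ} (hδ : 0 ≤ δ)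
    (hsw : ∀ x h : Fin n → ℝ, (1 - δ) * (h ⬝ᵥ h) ≤ A (x + h) + A (x - h) - 2 * A x ∧
      A (x + h) + A (x - h) - 2 * A x ≤ (1 + δ) * (h ⬝ᵥ h)) (x u : Fin n → ℝ) :
    (fun j => fderiv ℝ (fderiv ℝ A) x (Pi.single j 1) u - u j) ⬝ᵥ
        (fun j => fderiv ℝ (fderiv ℝ A) x (Pi.single j 1) u - u j) ≤ δ ^ 2 * (u ⬝ᵥ u) := by
  set B := fderiv ℝ (fderiv ℝ A) x with hB
  set s : Fin n → ℝ := fun j => B (Pi.single j 1) u - u j with hs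
  -- the defect form `D(z,w) := B z w − z·w` : symmetric, bilinear, `|D(v,v)| ≤ δ|v|²`
  have hsymm : ∀ z w, B z w = B w z := fderiv_fderiv_symm hA x
  have hdiag : ∀ v, |B v v - v ⬝ᵥ v| ≤ δ * (v ⬝ᵥ v) := by
    intro v
    have hup := fderiv_fderiv_le_of_secondDiff_le hA (fun y h => (hsw y h).2) x v
    have hlo := le_fderiv_fderiv_of_le_secondDiff hA (fun y h => (hsw y h).1) x v
    rw [abs_le]; constructor <;> nlinarith
  -- `D(z, u) = s·z` for every `z`
  have hDz : ∀ z, B z u - z ⬝ᵥ u = s ⬝ᵥ z := by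
    intro z
    rw [show B z u = B.flip u z from (B.flip_apply z u).symm, clm_apply_eq_sum_single (B.flip u) z]
    simp only [ContinuousLinearMap.flip_apply, hs, dotProduct, sub_mul, Finset.sum_sub_distrib]
    congr 1
    · exact Finset.sum_congr rfl fun j _ => by ring
    · exact Finset.sum_congr rfl fun j _ => by ring
  -- polarisation with a free parameter `t`: `|D(t z, u)| ≤ (δ/2)(t²|z|² + |u|²)`
  have hpol : ∀ (z : Fin n → ℝ) (t : ℝ),
      t * (s ⬝ᵥ z) ≤ δ / 2 * (t ^ 2 * (z ⬝ᵥ z) + u ⬝ᵥ u) ∧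
      -(t * (s ⬝ᵥ z)) ≤ δ / 2 * (t ^ 2 * (z ⬝ᵥ z) + u ⬝ᵥ u) := by
    intro z t
    have e : t * (s ⬝ᵥ z) = B (t • z) u - (t • z) ⬝ᵥ u := by
      rw [hDz (t • z), dotProduct_smul, smul_eq_mul]
    have h1 := hdiag (t • z + u)
    have h2 := hdiag (t • z - u)
    have epol : B (t • z) u - (t • z) ⬝ᵥ u =
        ((B (t • z + u) (t • z + u) - (t • z + u) ⬝ᵥ (t • z + u)) -
          (B (t • z - u) (t • z - u) - (t • z - u) ⬝ᵥ (t • z - u))) / 4 := by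
      simp only [map_add, map_sub, add_apply, sub_apply, add_dotProduct, dotProduct_add,
        sub_dotProduct, dotProduct_sub, hsymm u (t • z), dotProduct_comm u (t • z)]
      ring
    have hn1 : (t • z + u) ⬝ᵥ (t • z + u) + (t • z - u) ⬝ᵥ (t • z - u) =
        2 * (t ^ 2 * (z ⬝ᵥ z) + u ⬝ᵥ u) := by
      simp only [add_dotProduct, dotProduct_add, sub_dotProduct, dotProduct_sub, smul_dotProduct,
        dotProduct_smul, smul_eq_mul, dotProduct_comm u z]
      ring
    rw [e, epol]
    rw [abs_le] at h1 h2
    constructor <;> nlinarith [h1.1, h1.2, h2.1, h2.2, hn1]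
  -- discriminant: `(s·z)² ≤ δ²|z|²|u|²`, then `z = s`
  have hss : 0 ≤ s ⬝ᵥ s := by simpa using dotProduct_self_star_nonneg s
  have huu : 0 ≤ u ⬝ᵥ u := by simpa using dotProduct_self_star_nonneg u
  have hquad : ∀ t : ℝ, 0 ≤ δ / 2 * (s ⬝ᵥ s) * (t * t) + (-(s ⬝ᵥ s)) * t + δ / 2 * (u ⬝ᵥ u) := by
    intro t
    have := (hpol s t).1
    nlinarith
  have hdisc := discrim_le_zero hquad
  rw [discrim] at hdisc
  -- `(s·s)² ≤ 4 (δ/2 s·s)(δ/2 u·u) = δ² (s·s)(u·u)`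
  have h4 : (s ⬝ᵥ s) * (s ⬝ᵥ s) ≤ (s ⬝ᵥ s) * (δ ^ 2 * (u ⬝ᵥ u)) := by nlinarith
  rcases hss.lt_or_eq with hpos | hzero
  · exact le_of_mul_le_mul_left h4 hpos
  · rw [← hzero]; positivity


/-! ## Growth bookkeeping -/

/-- `|w·x| ≤ (∑|w_j|)(1+‖x‖)`. [folklore] -/
theorem abs_dotProduct_le_growth (w x : Fin n → ℝ) : |w ⬝ᵥ x| ≤ (∑ j, |w j|) * (1 + ‖x‖) ^ 1 := by
  rw [pow_one]
  simp only [dotProduct]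
  calc |∑ j, w j * x j| ≤ ∑ j, |w j * x j| := Finset.abs_sum_le_sum_abs _ _
    _ ≤ ∑ j, |w j| * ‖x‖ := Finset.sum_le_sum fun j _ => by
        rw [abs_mul]
        exact mul_le_mul_of_nonneg_left
          (by simpa [Real.norm_eq_abs] using norm_le_pi_norm x j) (abs_nonneg _)
    _ = (∑ j, |w j|) * ‖x‖ := by rw [Finset.sum_mul]
    _ ≤ (∑ j, |w j|) * (1 + ‖x‖) := by
        nlinarith [Finset.sum_nonneg (fun j (_ : j ∈ Finset.univ) => abs_nonneg (w j))]

/-- Growth of the quadratic observable `q = xᵀHx + bᵀx` and of its partials (`H` symmetric). [folklore] -/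
theorem quadObs_growth {H : Matrix (Fin n) (Fin n) ℝ} (hH : H.IsSymm) (b : Fin n → ℝ) :
    ∃ Dq Dq' : ℝ, 0 ≤ Dq ∧ 0 ≤ Dq' ∧ (∀ x : Fin n → ℝ, |x ⬝ᵥ H.mulVec x + b ⬝ᵥ x| ≤ Dq * (1 + ‖x‖) ^ 3) ∧
      ∀ (x : Fin n → ℝ) (j : Fin n),
        |fderiv ℝ (fun y : Fin n → ℝ => y ⬝ᵥ H.mulVec y + b ⬝ᵥ y) x (Pi.single j 1)| ≤ Dq' * (1 + ‖x‖) ^ 2 := by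
  obtain ⟨Dq, hDq0, hDq⟩ := exists_abs_quad_le H b
  have hc2 := fun j : Fin n => exists_abs_affine_apply_le ((2:ℝ) • H) b j
  choose Cj hCj0 hCj using hc2
  refine ⟨Dq, ∑ i, Cj i, hDq0, Finset.sum_nonneg fun i _ => hCj0 i, fun x => ?_, fun x j => ?_⟩
  · refine (hDq x).trans (mul_le_mul_of_nonneg_left ?_ hDq0)
    nlinarith [norm_nonneg x, sq_nonneg ‖x‖]
  · rw [fderiv_quadObs hH b x, dotProduct_single, mul_one]
    have h1 : |((2:ℝ) • H.mulVec x + b) j| ≤ Cj j * (1 + ‖x‖) := by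
      have := hCj j x
      rwa [Matrix.smul_mulVec] at this
    have ha : Cj j ≤ ∑ i, Cj i := Finset.single_le_sum (fun i _ => hCj0 i) (Finset.mem_univ j)
    have hb : 1 + ‖x‖ ≤ (1 + ‖x‖) ^ 2 := by nlinarith [norm_nonneg x]
    exact h1.trans (mul_le_mul ha hb (by positivity) (Finset.sum_nonneg fun i _ => hCj0 i))

/-! ## First-order Brascamp–Lieb on linear observables -/

/-- ROW BRASCAMP–LIEB: `∫ (w·x)² e^{−A} ≤ (1−δ)⁻¹ |w|² ∫e^{−A}` for a centred sandwiched `C²` potential.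
[folklore] -/
theorem integral_sq_dotProduct_le {A : (Fin n → ℝ) → ℝ} (hA : ContDiff ℝ 2 A) {δ : ℝ} (hδ1 : δ < 1)
    (hsw : ∀ x h : Fin n → ℝ, (1 - δ) * (h ⬝ᵥ h) ≤ A (x + h) + A (x - h) - 2 * A x ∧
      A (x + h) + A (x - h) - 2 * A x ≤ (1 + δ) * (h ⬝ᵥ h))
    (hcent : ∀ i : Fin n, ∫ x, x i * exp (-A x) = 0) (w : Fin n → ℝ) :
    ∫ x, (w ⬝ᵥ x) ^ 2 * exp (-A x) ≤ (1 - δ)⁻¹ * (w ⬝ᵥ w) * ∫ x, exp (-A x) := by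
  have hAc : Continuous A := hA.continuous
  obtain ⟨C₀, κ, _, hκ, hlb⟩ := exists_quadratic_lower_of_sandwich hAc hδ1 hsw
  have hZint : Integrable fun x => exp (-A x) := by
    have := integrable_mul_exp_neg_of_growth hAc continuous_const hκ (by norm_num : 0 ≤ 8) hlb
      (w := fun _ => (1:ℝ)) (D := 1) (fun x => by simp)
    simpa using this
  have hZ : 0 < ∫ x, exp (-A x) := integral_exp_pos hZint
  set F : (Fin n → ℝ) → ℝ := fun y => y ⬝ᵥ (0 : Matrix (Fin n) (Fin n) ℝ).mulVec y + w ⬝ᵥ y with hF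
  have hFw : ∀ y, F y = w ⬝ᵥ y := fun y => by simp [hF]
  have hFc : ContDiff ℝ 1 F := contDiff_quadObs 0 w
  have hFd : ∀ x v, fderiv ℝ F x v = w ⬝ᵥ v := fun x v => by
    rw [hF, fderiv_quadObs (Matrix.isSymm_zero) w x v]; simp
  have hFb : ∀ x, |F x| ≤ (∑ j, |w j|) * (1 + ‖x‖) ^ 3 := fun x => by
    rw [hFw]; exact growth_mono (by norm_num) (abs_dotProduct_le_growth w) x
  have hF'b : ∀ x (j : Fin n), |fderiv ℝ F x (Pi.single j 1)| ≤ (∑ i, |w i|) * (1 + ‖x‖) ^ 2 := by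
    intro x j
    rw [hFd, dotProduct_single, mul_one]
    have h2 : (1:ℝ) ≤ (1 + ‖x‖) ^ 2 := by nlinarith [norm_nonneg x]
    exact (Finset.single_le_sum (fun i _ => abs_nonneg (w i)) (Finset.mem_univ j)).trans
      (le_mul_of_one_le_right (Finset.sum_nonneg fun i _ => abs_nonneg _) h2)
  have hbl := bl_raw_of_sandwich hA hδ1 hsw hFc hFb hF'b
  have hgrad : ∀ x, coordGradient F x ⬝ᵥ coordGradient F x = w ⬝ᵥ w := by
    intro x
    have : coordGradient F x = w := by
      funext j; simp only [coordGradient, hFd, dotProduct_single, mul_one]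
    rw [this]
  simp only [hgrad, hFw] at hbl
  rw [integral_dotProduct_mul_exp_neg_eq_zero hAc hδ1 hsw hcent w, integral_const_mul] at hbl
  have : (∫ x, (w ⬝ᵥ x) ^ 2 * exp (-A x)) * (∫ x, exp (-A x)) ≤
      ((1 - δ)⁻¹ * (w ⬝ᵥ w) * ∫ x, exp (-A x)) * ∫ x, exp (-A x) := by nlinarith
  exact le_of_mul_le_mul_right this hZ

/-- ROW BRASCAMP–LIEB, summed: `∫ |Hx|² e^{−A} ≤ (1−δ)⁻¹ tr(H²) ∫e^{−A}` (`H` symmetric). [folklore] -/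
theorem integral_mulVec_sq_le {A : (Fin n → ℝ) → ℝ} (hA : ContDiff ℝ 2 A) {δ : ℝ} (hδ1 : δ < 1)
    (hsw : ∀ x h : Fin n → ℝ, (1 - δ) * (h ⬝ᵥ h) ≤ A (x + h) + A (x - h) - 2 * A x ∧
      A (x + h) + A (x - h) - 2 * A x ≤ (1 + δ) * (h ⬝ᵥ h))
    (hcent : ∀ i : Fin n, ∫ x, x i * exp (-A x) = 0) {H : Matrix (Fin n) (Fin n) ℝ} (hH : H.IsSymm) :
    ∫ x, (H.mulVec x ⬝ᵥ H.mulVec x) * exp (-A x) ≤ (1 - δ)⁻¹ * (H * H).trace * ∫ x, exp (-A x) := by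
  have hAc : Continuous A := hA.continuous
  obtain ⟨C₀, κ, _, hκ, hlb⟩ := exists_quadratic_lower_of_sandwich hAc hδ1 hsw
  have hτ : (H * H).trace = ∑ i, H i ⬝ᵥ H i := by
    rw [trace_mul_self_of_isSymm hH]; simp [dotProduct, sq]
  have hS2sum : ∫ x, (H.mulVec x ⬝ᵥ H.mulVec x) * exp (-A x) = ∑ i, ∫ x, (H i ⬝ᵥ x) ^ 2 * exp (-A x) := by
    rw [← integral_finsetSum]
    · congr 1; funext x
      rw [← Finset.sum_mul]
      congr 1
      simp [dotProduct, Matrix.mulVec, sq]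
    · intro i _
      have hb := abs_mul_le_growth (abs_dotProduct_le_growth (H i)) (abs_dotProduct_le_growth (H i))
      refine integrable_mul_exp_neg_of_growth hAc ((continuous_const.dotProduct continuous_id).pow 2)
        hκ (by norm_num : 1 + 1 ≤ 8) hlb (D := (∑ j, |H i j|) * (∑ j, |H i j|)) (fun x => ?_)
      rw [sq]; exact hb x
  rw [hS2sum, hτ, Finset.mul_sum, Finset.sum_mul]
  exact Finset.sum_le_sum fun i _ => integral_sq_dotProduct_le hA hδ1 hsw hcent (H i)

/-! ## Second moment of the score `∂_{Hx+b}A − tr H` -/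

/-- `∫ (∂_{Hx+b}A − trH)² e^{−A} ≤ tr(H²)·Z + (1+δ)(∫|Hx|²e^{−A} + |b|²·Z)` for a centred sandwiched `C²`
potential and symmetric `H`. [folklore] -/
theorem score_sq_le {A : (Fin n → ℝ) → ℝ} (hA : ContDiff ℝ 2 A) {δ : ℝ} (hδ : 0 ≤ δ) (hδ1 : δ < 1)
    (hsw : ∀ x h : Fin n → ℝ, (1 - δ) * (h ⬝ᵥ h) ≤ A (x + h) + A (x - h) - 2 * A x ∧
      A (x + h) + A (x - h) - 2 * A x ≤ (1 + δ) * (h ⬝ᵥ h))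
    (hcent : ∀ i : Fin n, ∫ x, x i * exp (-A x) = 0) {H : Matrix (Fin n) (Fin n) ℝ} (hH : H.IsSymm)
    (b : Fin n → ℝ) :
    ∫ x, (fderiv ℝ A x (H.mulVec x + b) - H.trace) ^ 2 * exp (-A x) ≤
      (H * H).trace * (∫ x, exp (-A x)) +
        (1 + δ) * ((∫ x, (H.mulVec x ⬝ᵥ H.mulVec x) * exp (-A x)) + (b ⬝ᵥ b) * ∫ x, exp (-A x)) := by
  have hAc : Continuous A := hA.continuous
  obtain ⟨C₀, κ, _, hκ, hlb⟩ := exists_quadratic_lower_of_sandwich hAc hδ1 hsw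
  have hZint : Integrable fun x => exp (-A x) := by
    have := integrable_mul_exp_neg_of_growth hAc continuous_const hκ (by norm_num : 0 ≤ 8) hlb
      (w := fun _ => (1:ℝ)) (D := 1) (fun x => by simp)
    simpa using this
  have hG2 := integral_score_sq hA hδ hδ1 hsw H b
  obtain ⟨CH, hCH0, hCH⟩ := exists_norm_affine_le H 0
  have hS2b : ∀ x, |H.mulVec x ⬝ᵥ H.mulVec x| ≤ (n : ℝ) * CH ^ 2 * (1 + ‖x‖) ^ 2 := fun x => by
    rw [abs_of_nonneg (by simpa using dotProduct_self_star_nonneg (H.mulVec x))]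
    have h1 := dotProduct_self_le_card_mul_norm_sq (H.mulVec x)
    have h2 : ‖H.mulVec x‖ ≤ CH * (1 + ‖x‖) := by simpa using hCH x
    have h3 : ‖H.mulVec x‖ ^ 2 ≤ CH ^ 2 * (1 + ‖x‖) ^ 2 := by
      rw [← mul_pow]; exact pow_le_pow_left₀ (norm_nonneg _) h2 2
    have hn : (0:ℝ) ≤ n := Nat.cast_nonneg n
    nlinarith [mul_le_mul_of_nonneg_left h3 hn]
  have hIS2 : Integrable fun x => (H.mulVec x ⬝ᵥ H.mulVec x) * exp (-A x) :=
    integrable_mul_exp_neg_of_growth hAc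
      ((continuous_const.matrix_mulVec continuous_id).dotProduct
        (continuous_const.matrix_mulVec continuous_id)) hκ (by norm_num) hlb hS2b
  have hIlin : ∀ w : Fin n → ℝ, Integrable fun x => (w ⬝ᵥ x) * exp (-A x) := fun w =>
    integrable_mul_exp_neg_of_growth hAc (continuous_const.dotProduct continuous_id) hκ
      (by norm_num : 1 ≤ 8) hlb (abs_dotProduct_le_growth w)
  have hlin0 : ∀ w : Fin n → ℝ, ∫ x, (w ⬝ᵥ x) * exp (-A x) = 0 :=
    integral_dotProduct_mul_exp_neg_eq_zero hAc hδ1 hsw hcent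
  have hIuu : ∫ x, ((H.mulVec x + b) ⬝ᵥ (H.mulVec x + b)) * exp (-A x) =
      (∫ x, (H.mulVec x ⬝ᵥ H.mulVec x) * exp (-A x)) + (b ⬝ᵥ b) * ∫ x, exp (-A x) := by
    have e : (fun x => ((H.mulVec x + b) ⬝ᵥ (H.mulVec x + b)) * exp (-A x)) = fun x =>
        (H.mulVec x ⬝ᵥ H.mulVec x) * exp (-A x) + (((2:ℝ) • H.mulVec b) ⬝ᵥ x) * exp (-A x) +
          (b ⬝ᵥ b) * exp (-A x) := by
      funext x
      have e1 : H.mulVec x ⬝ᵥ b = H.mulVec b ⬝ᵥ x := by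
        rw [← dotProduct_mulVec_of_isSymm hH x b, dotProduct_comm]
      have e2 : b ⬝ᵥ H.mulVec x = H.mulVec b ⬝ᵥ x := dotProduct_mulVec_of_isSymm hH b x
      simp only [add_dotProduct, dotProduct_add, smul_dotProduct, smul_eq_mul, e1, e2]
      ring
    have hI1 : Integrable fun x => (H.mulVec x ⬝ᵥ H.mulVec x) * exp (-A x) +
        (((2:ℝ) • H.mulVec b) ⬝ᵥ x) * exp (-A x) := hIS2.add (hIlin _)
    rw [e, integral_add hI1 (hZint.const_mul _), integral_add hIS2 (hIlin _), integral_const_mul, hlin0]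
    ring
  obtain ⟨Cu, hCu0, hCu⟩ := exists_norm_affine_le H b
  have huub : ∀ x, ‖H.mulVec x + b‖ ^ 2 ≤ Cu ^ 2 * (1 + ‖x‖) ^ 2 := fun x => by
    rw [← mul_pow]; exact pow_le_pow_left₀ (norm_nonneg _) (hCu x) 2
  have hn : (0:ℝ) ≤ n := Nat.cast_nonneg n
  have hIhess : Integrable fun x => fderiv ℝ (fderiv ℝ A) x (H.mulVec x + b) (H.mulVec x + b) * exp (-A x) := by
    refine integrable_mul_exp_neg_of_growth hAc
      (continuous_fderiv_fderiv_apply_of_contDiff hA (contDiff_affine H b).continuous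
        (contDiff_affine H b).continuous) hκ (by norm_num : 2 ≤ 8) hlb
      (D := (1 + δ) / 2 * ((n : ℝ) * Cu ^ 2 + (n : ℝ) * Cu ^ 2)) fun x => ?_
    have h := abs_fderiv_fderiv_le_norm hA hsw hδ x (H.mulVec x + b) (H.mulVec x + b)
    have hb := mul_le_mul_of_nonneg_left (huub x) hn
    have hd : 0 ≤ (1 + δ) / 2 := by positivity
    calc |fderiv ℝ (fderiv ℝ A) x (H.mulVec x + b) (H.mulVec x + b)|
        ≤ (1 + δ) / 2 * ((n : ℝ) * ‖H.mulVec x + b‖ ^ 2 + (n : ℝ) * ‖H.mulVec x + b‖ ^ 2) := h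
      _ ≤ (1 + δ) / 2 * ((n : ℝ) * (Cu ^ 2 * (1 + ‖x‖) ^ 2) + (n : ℝ) * (Cu ^ 2 * (1 + ‖x‖) ^ 2)) :=
          mul_le_mul_of_nonneg_left (add_le_add hb hb) hd
      _ = (1 + δ) / 2 * ((n : ℝ) * Cu ^ 2 + (n : ℝ) * Cu ^ 2) * (1 + ‖x‖) ^ 2 := by ring
  have hIuuI : Integrable fun x => ((H.mulVec x + b) ⬝ᵥ (H.mulVec x + b)) * exp (-A x) := by
    refine integrable_mul_exp_neg_of_growth hAc (((contDiff_affine H b).continuous).dotProduct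
      (contDiff_affine H b).continuous) hκ (by norm_num : 2 ≤ 8) hlb (D := (n : ℝ) * Cu ^ 2) fun x => ?_
    rw [abs_of_nonneg (by simpa using dotProduct_self_star_nonneg (H.mulVec x + b))]
    nlinarith [dotProduct_self_le_card_mul_norm_sq (H.mulVec x + b), mul_le_mul_of_nonneg_left (huub x) hn]
  have hHess : ∫ x, fderiv ℝ (fderiv ℝ A) x (H.mulVec x + b) (H.mulVec x + b) * exp (-A x) ≤
      (1 + δ) * ∫ x, ((H.mulVec x + b) ⬝ᵥ (H.mulVec x + b)) * exp (-A x) := by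
    rw [← integral_const_mul]
    refine integral_mono hIhess (hIuuI.const_mul _) fun x => ?_
    have h := fderiv_fderiv_le_of_secondDiff_le hA (fun y h => (hsw y h).2) x (H.mulVec x + b)
    have he : 0 ≤ exp (-A x) := (exp_pos _).le
    simp only
    nlinarith
  rw [hG2, ← hIuu]
  linarith

end Summit.QuantumFields.YangMills.Theorems.SandwichVariancePinching

end
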